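import Literature.MathematicalPhysics.QuantumFieldTheory.Balaban1983to89.B9Eq326DeltaAHQKLettersTower
import Literature.MathematicalPhysics.QuantumFieldTheory.Balaban1983to89.B9Eq3126QG1QInvPointDecayTower
import Literature.MathematicalPhysics.QuantumFieldTheory.Balaban1983to89.B9Eq316PenaltyPointwiseBoundHeightFree
import Literature.MathematicalPhysics.QuantumFieldTheory.Balaban1983to89.B9Eq3126ClosingRadiusWindowTower

/-!
# `Balaban1983to89.B9Eq3126QG1QInvPointDecayTowerClosedRadius` — T. Bałaban, *Propagators for lattice gauge theories in a background field*, Commun. Math. Phys.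
# **99** (1985) 389–434 [Balaban1985BackgroundPropagators] (3.126) p. 420, (3.26) p. 395, (3.15)–(3.19) p. 393, (3.49) p. 399, (3.79) p. 406, Thm 3.11 p. 416 with
# [Balaban1985Variational] (45) p. 285 («`QG₁Q*` … is invertible»), (110) p. 294: **THE COARSE-BOND POINT DECAY OF THE FOURTH PRIMITIVE ROW `(Q_kG₁,k(U)Q_k†)⁻¹`
# AT EVERY HEIGHT, EVERY CONJUGATION ∕ SIZE LETTER DISCHARGED AND THE RATE CHOSEN ONCE — `∃ r₀ > 0` IN CLOSED FORM BEFORE `∀ n η c₀ c₁ m U`** — this lineage's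
# (QGDT) `B9Eq3126QG1QInvPointDecayTower.norm_bondPoint_Kinv_le` with its `hQK` bundle INHABITED by the OWNER t4-ne9-p1 g94's (HQKT)
# `B9Eq326DeltaAHQKLettersTower.hQK_of_chain_tower`, the tower `C_P` letter (`…QuarterKappaTower`), g92's `p_K` floor (`B9Eq369CurvFormL2.re_inner_curvOp_self_ge`),
# the height-free `hQ` (`B9Eq316PenaltyPointwiseBoundHeightFree.norm_QkW_le_of_geometric_window`), «`Q_k` onto» (`QkW_surjective`), at the closing radius of
# `B9Eq3126ClosingRadiusWindowTower` (`ℓ = ℓ′ = 1`, `β := N_βr₀`, `β′ := N′r₀`, `β_K := 8p_K⁰r₀`, `ρ := (6X + 9X)∕√κ₁`; the tower `dQ` window linearised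
# height-free on the diagonal `ηL^{n+1} = 1`, `c₀(L^{n+1})^d = c₁`) — the `(QG₁Q†)⁻¹` twin of `B9Eq3126H1BlockDecayTowerClosedRadius` ∕
# `B9Eq326DeltaABlockDecayTowerClosedRadius`; displayed: `γ` + `hpos`, `μ₁` (closed supplier `B9Eq3126QG1QLowerDiagonalClosed`), the `G′_k` side, `p_K⁰`, the
# MODEL letters

statement-level skeleton of published theorems with citation tags; proofs where landed; nothing here is a claim about the Yang–Mills mass gap

CITATION HEADER (lean-in-tree rule).  Audit cell `pub-balaban`, sub-cell `t4`, BINDER row NE9 (road ΔA-CT of the NE9 formalisation swarm, leaf prover 03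
`b2b-balaban-t4-ne9-formalise-leaf-03` gen 77).  Imports BY NAME: the OWNER's (HQKT) `B9Eq326DeltaAHQKLettersTower` (through it (TQ), (TR), (QC), (PDCT),
`…QuarterKappaTower`, `B9Eq369CurvFormL2`), this lineage's (QGDT) `B9Eq3126QG1QInvPointDecayTower` and (CRWT) `B9Eq3126ClosingRadiusWindowTower`, ne9-leaf-01's
`B9Eq316PenaltyPointwiseBoundHeightFree`.  Sources READ first-hand: [Balaban1985BackgroundPropagators] (`paper:balaban1985-cmp99-background-propagators`, journal page
= PDF page + 388) pp. 393, 395, 399, 406, 416, 420; [Balaban1985Variational] pp. 285, 294.  Print inverts `QG₁Q*` without comment and bounds kernels by the random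
walk; the cell's road is Combes–Thomas with explicit windows; `r₀` is the cell's closed form, NOT print's `δ₀`.

WHAT IS PROVED (sorry-free; proof lane — no `def`; [folklore] composition BY NAME + the arithmetic of `B9Eq3126ClosingRadiusWindowTower`).
* **`exists_rate_bondPoint_Kinv_closed`** — for the letters `(d, L ≥ 2, M_φ, M_φ′, M_τ, a, a′, ε_s, ϱ < 1, γ′ ≤ 1, κ₁, M, γ ≤ 1, μ₁, p_K⁰ < γ∕2)`: `∃ r₀`,
  `r₀ = ` the closed radius of `B9Eq3126ClosingRadiusWindowTower`, `0 < r₀`, and for every height `n`, spacing `η` (`ηL^{n+1} = 1`), weights on the diagonal,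
  lattice `m`, background `U` of the MODEL letters (unit ball, `hRS`, per-level regime `50(d+1)α_jL^d ≤ ½`, geometric profile `ε_j ≤ ε_sϱ^j`, plaquette
  letters `δ` with the curvature letter `≤ p_K⁰`), the `G′_k`-side letters, ANY positivity witness `hpos` of `Δ_{a,k}(U)` with `γ`-coercivity and the `hX1`
  floor `μ₁`, every coarse-bond point family `r_y`: `‖r_{y₁} ∘ (Q_kG₁,k(U)Q_k†)⁻¹ ∘ r_{y₀}‖ ≤ (2∕μ₁)e^{r₀}·e^{−r₀·d_m(y₀,y₁)}`.
HONEST SCOPE.  Composition; the letters `γ` + `hpos`, `μ₁`, `γ′`, `a′`, `hpos′`, `κ₁`, `M`, `p_K⁰` and the MODEL letters are INPUTS (closed suppliers in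
`B9Eq3126H1RowLettersDiagonalClosed`; assembled in the sequel `B9Eq3126QG1QInvPointDecayTowerDiagonalClosed`); crude constants; NOT print's `δ₀`, NOT a kernel
bound on the fine lattice; NOT NE9 (cell pub-balaban: NE9 NOT PRINTED ∕ NOT PROVED; «NE9 ⇐ the named binders»; row WALLED ON A MODEL (O-NE9-1; #5 UNRULED); spine
PROVED 0∕9; rung (B)+1 on a finite T⁴ — NOT infinite volume, NOT mass gap, NOT BetaPertH, NOT Clay; HONEST DEPENDENCY: continuum YM on T⁴ ⇐ BetaPertH ∧ nine spine
estimates (0/9 proved); BetaPertH ⇐ (D1) ∧ (D4) ∧ CAP+tail; G-an2-4 gates asym, D1 and NE2/3/4).  NEW file; nothing modified.  Net new unproved facts: 0.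
-/

noncomputable section

set_option autoImplicit false

open scoped InnerProductSpace ComplexConjugate BigOperators
open NormedSpace

namespace Literature.MathematicalPhysics.QuantumFieldTheory.Balaban1983to89.B9Eq3126QG1QInvPointDecayTowerClosedRadius

open B4Sect5Torus (TSite tdist)
open B4Sect5Proof (latticeConst)
open B9SectCLatticeCarrier (Bond DirPair bpos btgt)
open B9Eq311L2Pairing (WL2)
open B9Eq319QprimeTorus (fineP blockCoord)
open B9Eq315QTower (towerP UlevOf)
open B9Eq315QTorus (perCfg cornerSite)
open B7Prop1Explicit (U1 Wcx boxVec)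
open B9Eq316TowerFlatIsOneStep (siteCast towerP_eq_fineP_pow)
open B11Eq103H1Complex (SiteL2K BondL2K covDerivL2K covDivL2K KinvLatticeK)
open B9Eq310DeltaPrime (reHol imHol)
open B9Eq310HessianOperator (adTransportW curvOp)
open B9Eq326OperatorTower (laplaceAk RofUk G1k QkW QprimeTowerW QkW_surjective)
open B9Eq324DeltaPrimeATower (laplacePrimeAk GpOfUk)
open B9Eq3126QG1QInvPointDecayTower (norm_bondPoint_Kinv_le)
open B9Eq326DeltaAHQKLettersTower (hQK_of_chain_tower)
open B9Eq369CurvFormL2 (re_inner_curvOp_self_ge)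
open B9Eq316PenaltyPointwiseBoundHeightFree (norm_QkW_le_of_geometric_window)
open B9Eq3126ClosingRadiusWindowTower (radiusT0_pos le_ratios_of_le_radiusT0 eta_windows unit_windows slopes_le small_window small2_window
  tower_dQ_diff_le_linear)

variable {d : ℕ} (L : ℕ) [NeZero L] (hL2 : 2 ≤ L)
  {𝔸 : Type*} [NormedRing 𝔸] [StarRing 𝔸] [NormedAlgebra ℂ 𝔸] [StarModule ℂ 𝔸] [CompleteSpace 𝔸] [NormOneClass 𝔸]
  {W : Type*} [NormedAddCommGroup W] [InnerProductSpace ℂ W] [FiniteDimensional ℂ W] (φ : W ≃ₗ[ℂ] 𝔸) {Mφ Mφ' : ℝ}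
  (hφ : ∀ w, ‖φ w‖ ≤ Mφ * ‖w‖) (hφ' : ∀ X, ‖φ.symm X‖ ≤ Mφ' * ‖X‖) (hMφ : 0 ≤ Mφ) (hMφ' : 0 ≤ Mφ') (hstar : ∀ X : 𝔸, ‖star X‖ ≤ ‖X‖)
  (τ : 𝔸 →ₗ[ℂ] ℂ) {Mτ : ℝ} (hτ : ∀ X Y : 𝔸, ‖τ (X * Y)‖ ≤ Mτ * ‖X‖ * ‖Y‖) (hMτ : 0 ≤ Mτ)
  (a : ℝ) (ha : 0 ≤ a) {a' : ℝ} (ha' : 0 ≤ a') {ϱ εs : ℝ} (hϱ0 : 0 ≤ ϱ) (hϱ1 : ϱ < 1) (hεs : 0 ≤ εs)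
  {γ' κ₁ M : ℝ} (hγ' : 0 < γ') (hγ'1 : γ' ≤ 1) (hκ₁ : 0 < κ₁) (hM : 0 ≤ M)
  {γ μ₁ pK0 : ℝ} (hγ : 0 < γ) (hγ1 : γ ≤ 1) (hμ₁ : 0 < μ₁) (hpK0 : 0 ≤ pK0) (hgap : pK0 < γ / 2)

set_option maxHeartbeats 1600000 in
include hL2 hφ hφ' hMφ hMφ' hstar hτ hMτ ha ha' hϱ0 hϱ1 hεs hγ' hγ'1 hκ₁ hM hγ hγ1 hμ₁ hpK0 hgap in
/-- **THE POINT DECAY OF `(Q_kG₁,k(U)Q_k†)⁻¹` AT EVERY HEIGHT, THE RATE CHOSEN ONCE: `∃ r₀ > 0` (closed form) BEFORE `∀ n η c₀ c₁ m U`.**  (QGDT)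
`norm_bondPoint_Kinv_le` at `r := r₀`, `ℓ = ℓ′ = 1`, `β := N_βr₀`, `β′ := N′r₀`, `β_K := 8p_K⁰r₀`, `ρ := (6X + 9X)∕√κ₁`, `hQK := hQK_of_chain_tower` (OWNER g94),
`hP :=` the tower `C_P` letter, `hKre :=` g92, `hQ := norm_QkW_le_of_geometric_window`, `hQs := QkW_surjective`, every radius window by `B9Eq3126ClosingRadiusWindowTower`.
Displayed: `γ` + `hpos`, `μ₁`, the `G′_k` side, the MODEL letters. [cite: Balaban1985BackgroundPropagators, (3.126) p.420, (3.26) p.395, (3.15)–(3.19) p.393,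
(3.49) p.399, (3.79) p.406, Thm 3.11 p.416; Balaban1985Variational, (45) p.285, (110) p.294] -/
theorem exists_rate_bondPoint_Kinv_closed (d : ℕ) :
    ∃ r₀ : ℝ, r₀ = min (1 / 4) (min (1 / (2 * (d : ℝ) + 1)) (min (1 / (4 * (Mφ * Mφ') * (d * Real.sqrt d) + 4 * (Mφ * Mφ') * d + 2 * (Mφ * Mφ') * Real.sqrt d + Mφ' * Mφ * (Real.exp 1 * Real.exp (Real.sqrt ((L : ℝ) ^ d) * (Real.sqrt (2 * d) * (102 * (d + 1) ^ 2 * L)) * (εs / (1 - ϱ))) * (Real.sqrt ((L : ℝ) ^ d) * ((3 * 1 + (2 * d + 1) * 1) * (2 * Real.sqrt (2 * (2 * d * (102 * (d + 1) ^ 2 * L * εs) ^ 2 + 1)))))) + 1)) (min (1 / (Real.sqrt ((L : ℝ) ^ d) * ((3 * 1 + (2 * d + 1) * 1) * (2 * Real.sqrt (2 * (2 * d * (102 * (d + 1) ^ 2 * L * εs) ^ 2 + 1)))))) (min (1 / (2 * (Mφ * Mφ') * Real.sqrt d + 2 * M + 1)) (min (γ' / (12 * (1 + a') * (2 * (Mφ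 * Mφ') * Real.sqrt d + 2 * M + 1))) (min (Real.sqrt κ₁ / (120 * ((2 * (Mφ * Mφ') * Real.sqrt d + 2 * M + 1) * (4 / γ' + M * ((4 / γ') ^ 2 * (3 + a' * (2 * M + 1))))))) (min ((γ / 4 - pK0 / 2) / ((21 + 3 * a) * (4 * (Mφ * Mφ') * (d * Real.sqrt d) + 4 * (Mφ * Mφ') * d + 2 * (Mφ * Mφ') * Real.sqrt d + Mφ' * Mφ * (Real.exp 1 * Real.exp (Real.sqrt ((L : ℝ) ^ d) * (Real.sqrt (2 * d) * (102 * (d + 1) ^ 2 * L)) * (εs / (1 - ϱ))) * (Real.sqrt ((L : ℝ) ^ d) * ((3 * 1 + (2 * d + 1) * 1) * (2 * Real.sqrt (2 * (2 * d * (102 * (d + 1) ^ 2 * L * εs) ^ 2 + 1)))))) + 1) + 4 * (4 * (Mφ * Mφ') * (d * Real.sqrt d) + 4 * (Mφ * Mφ') * d + 2 * (Mφ * Mφ') * Real.sqrt d + Mφ' * Mφ * (Real.exp 1 * Real.exp (Real.sqrt ((L : ℝ) ^ d) * (Real.sqrt (2 * d) * (102 * (d + 1) ^ 2 * L)) * (εs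 / (1 - ϱ))) * (Real.sqrt ((L : ℝ) ^ d) * ((3 * 1 + (2 * d + 1) * 1) * (2 * Real.sqrt (2 * (2 * d * (102 * (d + 1) ^ 2 * L * εs) ^ 2 + 1)))))) + 1) * Real.sqrt (M / Real.sqrt κ₁) + 2 * (15 * ((2 * (Mφ * Mφ') * Real.sqrt d + 2 * M + 1) * (4 / γ' + M * ((4 / γ') ^ 2 * (3 + a' * (2 * M + 1))))) / Real.sqrt κ₁) * Real.sqrt (M / Real.sqrt κ₁) ^ 2 + 8 * pK0)) ((μ₁ / 2) / ((4 * (Mφ * Mφ') * (d * Real.sqrt d) + 4 * (Mφ * Mφ') * d + 2 * (Mφ * Mφ') * Real.sqrt d + Mφ' * Mφ * (Real.exp 1 * Real.exp (Real.sqrt ((L : ℝ) ^ d) * (Real.sqrt (2 * d) * (102 * (d + 1) ^ 2 * L)) * (εs / (1 - ϱ))) * (Real.sqrt ((L : ℝ) ^ d) * ((3 * 1 + (2 * d + 1) * 1) * (2 * Real.sqrt (2 * (2 * d * (102 * (d + 1) ^ 2 * L * εs) ^ 2 + 1)))))) + 1) * (4 / γ) * (2 * (Mφ' * Mφ * Real.exp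 (Real.sqrt ((L : ℝ) ^ d) * (Real.sqrt (2 * d) * (102 * (d + 1) ^ 2 * L)) * (εs / (1 - ϱ)))) + 1) + (Mφ' * Mφ * Real.exp (Real.sqrt ((L : ℝ) ^ d) * (Real.sqrt (2 * d) * (102 * (d + 1) ^ 2 * L)) * (εs / (1 - ϱ)))) * ((Mφ' * Mφ * Real.exp (Real.sqrt ((L : ℝ) ^ d) * (Real.sqrt (2 * d) * (102 * (d + 1) ^ 2 * L)) * (εs / (1 - ϱ)))) + 1) * ((4 * (Mφ * Mφ') * (d * Real.sqrt d) + 4 * (Mφ * Mφ') * d + 2 * (Mφ * Mφ') * Real.sqrt d + Mφ' * Mφ * (Real.exp 1 * Real.exp (Real.sqrt ((L : ℝ) ^ d) * (Real.sqrt (2 * d) * (102 * (d + 1) ^ 2 * L)) * (εs / (1 - ϱ))) * (Real.sqrt ((L : ℝ) ^ d) * ((3 * 1 + (2 * d + 1) * 1) * (2 * Real.sqrt (2 * (2 * d * (102 * (d + 1) ^ 2 * L * εs) ^ 2 + 1)))))) + 1) * (4 / γ * (2 * (8 / γ) + (8 / γ + 4 / γ) + 2 * ((8 / γ + 4 / γ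 * Real.sqrt (M / Real.sqrt κ₁)) + 4 / γ) + a * (Mφ' * Mφ * Real.exp (Real.sqrt ((L : ℝ) ^ d) * (Real.sqrt (2 * d) * (102 * (d + 1) ^ 2 * L)) * (εs / (1 - ϱ)))) * (4 / γ) + a * ((Mφ' * Mφ * Real.exp (Real.sqrt ((L : ℝ) ^ d) * (Real.sqrt (2 * d) * (102 * (d + 1) ^ 2 * L)) * (εs / (1 - ϱ)))) + 1) * (4 / γ))) + (15 * ((2 * (Mφ * Mφ') * Real.sqrt d + 2 * M + 1) * (4 / γ' + M * ((4 / γ') ^ 2 * (3 + a' * (2 * M + 1))))) / Real.sqrt κ₁) * ((8 / γ + 4 / γ * Real.sqrt (M / Real.sqrt κ₁)) * ((8 / γ + 4 / γ * Real.sqrt (M / Real.sqrt κ₁)) + 4 / γ)) + 8 * pK0 * (4 / γ) ^ 2)))))))))) ∧ 0 < r₀ ∧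
      ∀ (n : ℕ) (η : ℝ) (_hη : 0 < η) (_hηL : η * (L : ℝ) ^ (n + 1) = 1) (c₀ c₁ : ℝ) [Fact (0 < c₀)] [Fact (0 < c₁)]
        (_hdiag : c₀ * ((L : ℝ) ^ (n + 1)) ^ d = c₁) (m : Fin d → ℕ) [∀ i, NeZero (m i)] (_hm : ∀ i, 1 ≤ m i)
        (U : Bond d (towerP L m (n + 1)) → 𝔸ˣ) (_hU : ∀ b, U b ∈ U1 𝔸)
        (_hRS : ∀ (b : Bond d (towerP L m (n + 1))) (v u : W), ⟪adTransportW φ U b v, u⟫_ℂ = ⟪v, adTransportW φ (fun b => (U b)⁻¹) b u⟫_ℂ)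
        (α : ℕ → ℝ) (_hα0 : ∀ j, 0 ≤ α j) (hα1 : ∀ j, α j ≤ 1 / 64) (hαL : ∀ j, 50 * (d + 1) * α j * (L : ℝ) ^ d ≤ 1 / 2)
        (hU1 : ∀ (j : ℕ) (x : B7Prop1Explicit.Site d) (k : Fin d), perCfg (towerP L m (j + 1)) (UlevOf L m (n + 1) U j) x k ∈ U1 𝔸)
        (hreg : ∀ (j : ℕ) (y : TSite d (towerP L m j)) (k : Fin d) (ρ' : Fin d → Fin L),
          ‖((Wcx L (perCfg (towerP L m (j + 1)) (UlevOf L m (n + 1) U j)) (cornerSite L y) k (boxVec L ρ') : 𝔸ˣ) : 𝔸) - 1‖ ≤ α j)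
        (εU : ℕ → ℝ) (_hεU : ∀ j, 0 ≤ εU j) (_hUε : ∀ (j : ℕ) (b : Bond d (towerP L m (j + 1))), ‖(UlevOf L m (n + 1) U j b : 𝔸) - 1‖ ≤ εU j)
        (_hεg : ∀ j < n + 1, εU j ≤ εs * ϱ ^ j)
        (δ : ℝ) (_hδ : 0 ≤ δ) (_hRe : ∀ p : B9SectCLatticeCarrier.Plaq d (towerP L m (n + 1)), ‖reHol U p - 1‖ ≤ δ)
        (_hIm : ∀ p : B9SectCLatticeCarrier.Plaq d (towerP L m (n + 1)), ‖imHol U p‖ ≤ δ)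
        (_hpK : (768 * Fintype.card (DirPair d) * Mτ * Mφ ^ 2 * (‖((η : ℂ)) ^ d‖ / c₀) * ‖((η : ℂ))⁻¹‖ ^ 2 * δ) ≤ pK0)
        (hpos' : ∀ x : SiteL2K ℂ d (towerP L m (n + 1)) c₀ W, x ≠ 0 → 0 < RCLike.re ⟪x, laplacePrimeAk L m n φ η U a' (c₁ := c₁) x⟫_ℂ)
        (_coercive : ∀ f : SiteL2K ℂ d (towerP L m (n + 1)) c₀ W, γ' * ‖f‖ ^ 2 ≤ ‖(covDerivL2K ℂ c₀ ((η : ℂ))⁻¹ (adTransportW φ U)) f‖ ^ 2 +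
          a' * ‖((WL2.linearEquiv ℂ ℂ (fun _ : TSite d m => c₁)).symm.toLinearMap ∘ₗ QprimeTowerW L m n φ U (c₀ := c₀)) f‖ ^ 2)
        (_hκ : ∀ ψ : SiteL2K ℂ d m c₁ W, κ₁ * ‖ψ‖ ^ 2 ≤ RCLike.re ⟪ψ,
          (((WL2.linearEquiv ℂ ℂ (fun _ : TSite d m => c₁)).symm.toLinearMap ∘ₗ QprimeTowerW L m n φ U (c₀ := c₀)) ∘ₗ
            GpOfUk L m n φ η U a' (c₁ := c₁) hpos' ∘ₗ GpOfUk L m n φ η U a' (c₁ := c₁) hpos' ∘ₗ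
            LinearMap.adjoint ((WL2.linearEquiv ℂ ℂ (fun _ : TSite d m => c₁)).symm.toLinearMap ∘ₗ QprimeTowerW L m n φ U (c₀ := c₀))) ψ⟫_ℂ)
        (_hMQ : ∀ s : SiteL2K ℂ d (towerP L m (n + 1)) c₀ W,
          ‖((WL2.linearEquiv ℂ ℂ (fun _ : TSite d m => c₁)).symm.toLinearMap ∘ₗ QprimeTowerW L m n φ U (c₀ := c₀)) s‖ ≤ M * ‖s‖)
        (hpos : ∀ x : BondL2K ℂ d (towerP L m (n + 1)) c₀ W, x ≠ 0 →
          0 < RCLike.re ⟪x, laplaceAk L m n φ η U (le_trans one_le_two hL2) α hα1 hU1 hreg τ (c₀ := c₀) (c₁ := c₁) a x⟫_ℂ)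
        (_hcoer : ∀ f : BondL2K ℂ d (towerP L m (n + 1)) c₀ W, γ * ‖f‖ ^ 2 ≤
          RCLike.re ⟪f, laplaceAk L m n φ η U (le_trans one_le_two hL2) α hα1 hU1 hreg τ (c₀ := c₀) (c₁ := c₁) a f⟫_ℂ)
        (_hX1 : ∀ g : BondL2K ℂ d m c₁ W, μ₁ * ‖g‖ ^ 2 ≤
          RCLike.re ⟪g, (QkW L m n φ U (le_trans one_le_two hL2) α hα1 hU1 hreg (c₀ := c₀) (c₁ := c₁))
            (G1k L m n φ η U (le_trans one_le_two hL2) α hα1 hU1 hreg τ (c₀ := c₀) (c₁ := c₁) hpos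
              (LinearMap.adjoint (QkW L m n φ U (le_trans one_le_two hL2) α hα1 hU1 hreg (c₀ := c₀) (c₁ := c₁)) g))⟫_ℂ)
        (rF : TSite d m → BondL2K ℂ d m c₁ W →L[ℂ] BondL2K ℂ d m c₁ W)
        (_hrF : ∀ (y : TSite d m) (g : BondL2K ℂ d m c₁ W) (b' : Bond d m),
          WL2.equiv ℂ (fun _ : Bond d m => c₁) W (rF y g) b' = if bpos b' = y then WL2.equiv ℂ (fun _ : Bond d m => c₁) W g b' else 0)
        (y₀ y₁ : TSite d m),
        ‖rF y₁ ∘L LinearMap.toContinuousLinearMap (KinvLatticeK hpos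
            (QkW_surjective L m n φ U (le_trans one_le_two hL2) α hα1 hU1 hreg (c₀ := c₀) (c₁ := c₁) hαL)) ∘L rF y₀‖ ≤
          2 / μ₁ * Real.exp r₀ * Real.exp (-(r₀ * tdist m y₀ y₁)) := by
  have hL1 : 1 ≤ L := le_trans one_le_two hL2
  refine ⟨_, rfl, radiusT0_pos (d := d) (εs := εs) (ϱ := ϱ) hL1 hMφ hMφ' ha ha' hγ' hκ₁ hM hγ hμ₁ hpK0 hgap, ?_⟩
  intro n η hη hηL c₀ c₁ _ _ hdiag m _ hm U hU hRS α hα0 hα1 hαL hU1 hreg εU hεU hUε hεg δ hδ hRe hIm hpK hpos' coercive hκ hMQ hpos hcoer hX1 rF hrF y₀ y₁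
  -- the radius and its nine ratio bounds
  set r₀ : ℝ := min (1 / 4) (min (1 / (2 * (d : ℝ) + 1)) (min (1 / (4 * (Mφ * Mφ') * (d * Real.sqrt d) + 4 * (Mφ * Mφ') * d + 2 * (Mφ * Mφ') * Real.sqrt d + Mφ' * Mφ * (Real.exp 1 * Real.exp (Real.sqrt ((L : ℝ) ^ d) * (Real.sqrt (2 * d) * (102 * (d + 1) ^ 2 * L)) * (εs / (1 - ϱ))) * (Real.sqrt ((L : ℝ) ^ d) * ((3 * 1 + (2 * d + 1) * 1) * (2 * Real.sqrt (2 * (2 * d * (102 * (d + 1) ^ 2 * L * εs) ^ 2 + 1)))))) + 1)) (min (1 / (Real.sqrt ((L : ℝ) ^ d) * ((3 * 1 + (2 * d + 1) * 1) * (2 * Real.sqrt (2 * (2 * d * (102 * (d + 1) ^ 2 * L * εs) ^ 2 + 1)))))) (min (1 / (2 * (Mφ * Mφ') * Real.sqrt d + 2 * M + 1)) (min (γ' / (12 * (1 + a') * (2 * (Mφ * Mφ') * Real.sqrt d + 2 * M + 1))) (min (Real.sqrt κ₁ / (120 * ((2 * (Mφ * Mφ') * Real.sqrt d + 2 * M +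 1) * (4 / γ' + M * ((4 / γ') ^ 2 * (3 + a' * (2 * M + 1))))))) (min ((γ / 4 - pK0 / 2) / ((21 + 3 * a) * (4 * (Mφ * Mφ') * (d * Real.sqrt d) + 4 * (Mφ * Mφ') * d + 2 * (Mφ * Mφ') * Real.sqrt d + Mφ' * Mφ * (Real.exp 1 * Real.exp (Real.sqrt ((L : ℝ) ^ d) * (Real.sqrt (2 * d) * (102 * (d + 1) ^ 2 * L)) * (εs / (1 - ϱ))) * (Real.sqrt ((L : ℝ) ^ d) * ((3 * 1 + (2 * d + 1) * 1) * (2 * Real.sqrt (2 * (2 * d * (102 * (d + 1) ^ 2 * L * εs) ^ 2 + 1)))))) + 1) + 4 * (4 * (Mφ * Mφ') * (d * Real.sqrt d) + 4 * (Mφ * Mφ') * d + 2 * (Mφ * Mφ') * Real.sqrt d + Mφ' * Mφ * (Real.exp 1 * Real.exp (Real.sqrt ((L : ℝ) ^ d) * (Real.sqrt (2 * d) * (102 * (d + 1) ^ 2 * L)) * (εs / (1 - ϱ))) * (Real.sqrt ((L : ℝ) ^ d) * ((3 * 1 + (2 * d + 1) * 1) * (2 * Real.sqrt (2 * (2 *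 d * (102 * (d + 1) ^ 2 * L * εs) ^ 2 + 1)))))) + 1) * Real.sqrt (M / Real.sqrt κ₁) + 2 * (15 * ((2 * (Mφ * Mφ') * Real.sqrt d + 2 * M + 1) * (4 / γ' + M * ((4 / γ') ^ 2 * (3 + a' * (2 * M + 1))))) / Real.sqrt κ₁) * Real.sqrt (M / Real.sqrt κ₁) ^ 2 + 8 * pK0)) ((μ₁ / 2) / ((4 * (Mφ * Mφ') * (d * Real.sqrt d) + 4 * (Mφ * Mφ') * d + 2 * (Mφ * Mφ') * Real.sqrt d + Mφ' * Mφ * (Real.exp 1 * Real.exp (Real.sqrt ((L : ℝ) ^ d) * (Real.sqrt (2 * d) * (102 * (d + 1) ^ 2 * L)) * (εs / (1 - ϱ))) * (Real.sqrt ((L : ℝ) ^ d) * ((3 * 1 + (2 * d + 1) * 1) * (2 * Real.sqrt (2 * (2 * d * (102 * (d + 1) ^ 2 * L * εs) ^ 2 + 1)))))) + 1) * (4 / γ) * (2 * (Mφ' * Mφ * Real.exp (Real.sqrt ((L : ℝ) ^ d) * (Real.sqrt (2 * d) * (102 * (d + 1) ^ 2 * L)) * (εs / (1 - ϱ)))) +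 1) + (Mφ' * Mφ * Real.exp (Real.sqrt ((L : ℝ) ^ d) * (Real.sqrt (2 * d) * (102 * (d + 1) ^ 2 * L)) * (εs / (1 - ϱ)))) * ((Mφ' * Mφ * Real.exp (Real.sqrt ((L : ℝ) ^ d) * (Real.sqrt (2 * d) * (102 * (d + 1) ^ 2 * L)) * (εs / (1 - ϱ)))) + 1) * ((4 * (Mφ * Mφ') * (d * Real.sqrt d) + 4 * (Mφ * Mφ') * d + 2 * (Mφ * Mφ') * Real.sqrt d + Mφ' * Mφ * (Real.exp 1 * Real.exp (Real.sqrt ((L : ℝ) ^ d) * (Real.sqrt (2 * d) * (102 * (d + 1) ^ 2 * L)) * (εs / (1 - ϱ))) * (Real.sqrt ((L : ℝ) ^ d) * ((3 * 1 + (2 * d + 1) * 1) * (2 * Real.sqrt (2 * (2 * d * (102 * (d + 1) ^ 2 * L * εs) ^ 2 + 1)))))) + 1) * (4 / γ * (2 * (8 / γ) + (8 / γ + 4 / γ) + 2 * ((8 / γ + 4 / γ * Real.sqrt (M / Real.sqrt κ₁)) + 4 / γ) + a * (Mφ' * Mφ * Real.exp (Real.sqrt ((L : ℝ) ^ d) *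 (Real.sqrt (2 * d) * (102 * (d + 1) ^ 2 * L)) * (εs / (1 - ϱ)))) * (4 / γ) + a * ((Mφ' * Mφ * Real.exp (Real.sqrt ((L : ℝ) ^ d) * (Real.sqrt (2 * d) * (102 * (d + 1) ^ 2 * L)) * (εs / (1 - ϱ)))) + 1) * (4 / γ))) + (15 * ((2 * (Mφ * Mφ') * Real.sqrt d + 2 * M + 1) * (4 / γ' + M * ((4 / γ') ^ 2 * (3 + a' * (2 * M + 1))))) / Real.sqrt κ₁) * ((8 / γ + 4 / γ * Real.sqrt (M / Real.sqrt κ₁)) * ((8 / γ + 4 / γ * Real.sqrt (M / Real.sqrt κ₁)) + 4 / γ)) + 8 * pK0 * (4 / γ) ^ 2)))))))))) with hr₀def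
  have hr₀pos : 0 < r₀ := radiusT0_pos (d := d) (εs := εs) (ϱ := ϱ) hL1 hMφ hMφ' ha ha' hγ' hκ₁ hM hγ hμ₁ hpK0 hgap
  have hr0 : 0 ≤ r₀ := hr₀pos.le
  obtain ⟨h1, h2, h3, h4, h5, h6, h7, h8, h9⟩ := le_ratios_of_le_radiusT0 (le_refl r₀)
  -- the windows
  obtain ⟨hwin, hwin0, hwin1, hwin'⟩ := eta_windows (d := d) hL1 n hη hηL hr0 h1 h2
  obtain ⟨hβ0, hβ1, hβ'0, hβ'1, small', hwinκ, hρ0, hρ8, hwinT⟩ := unit_windows hL1 hMφ hMφ' ha' hγ' hκ₁ hM hr0 h3 h4 h5 h6 h7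
  obtain ⟨hβCC, hβC, hβD, hβTs, hβ'D, hβ'Q, hβK0⟩ := slopes_le (d := d) (L := L) (εs := εs) (ϱ := ϱ) hMφ hMφ' hM hpK0 hr0
  have hsmall := small_window hL1 hMφ hMφ' ha ha' hγ' hκ₁ hM hpK0 hr0 h3 h8
  have hsmall2 := small2_window hL1 hMφ hMφ' ha ha' hγ' hκ₁ hM hγ hpK0 h9
  -- the diagonal weight ratio is `1`
  have hc₀ : 0 < c₀ := Fact.out
  have hW1 : Real.sqrt (c₁ / (c₀ * ((L : ℝ) ^ (n + 1)) ^ d)) = 1 := by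
    rw [← hdiag, div_self (by positivity), Real.sqrt_one]
  -- `η ≤ 1` and the curvature letter
  have hL1r : (1 : ℝ) ≤ (L : ℝ) ^ (n + 1) := one_le_pow₀ (by exact_mod_cast hL1)
  have hη1 : η ≤ 1 := by
    have hηeq : η = ((L : ℝ) ^ (n + 1))⁻¹ := eq_inv_of_mul_eq_one_left hηL
    rw [hηeq]; exact inv_le_one_of_one_le₀ hL1r
  have hpKnn : 0 ≤ (768 * Fintype.card (DirPair d) * Mτ * Mφ ^ 2 * (‖((η : ℂ)) ^ d‖ / c₀) * ‖((η : ℂ))⁻¹‖ ^ 2 * δ) := by positivity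
  have hβK : 8 * (r₀ * (1 * η)) * (768 * Fintype.card (DirPair d) * Mτ * Mφ ^ 2 * (‖((η : ℂ)) ^ d‖ / c₀) * ‖((η : ℂ))⁻¹‖ ^ 2 * δ) ≤ 8 * pK0 * r₀ := by
    have h1' : r₀ * (1 * η) ≤ r₀ := by rw [one_mul]; exact mul_le_of_le_one_right hr0 hη1
    calc 8 * (r₀ * (1 * η)) * (768 * Fintype.card (DirPair d) * Mτ * Mφ ^ 2 * (‖((η : ℂ)) ^ d‖ / c₀) * ‖((η : ℂ))⁻¹‖ ^ 2 * δ) ≤ 8 * r₀ * pK0 := by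
          apply mul_le_mul (by linarith) hpK hpKnn (by positivity)
      _ = 8 * pK0 * r₀ := by ring
  -- the tower `dQ` window, linearised
  have hdiff := tower_dQ_diff_le_linear (d := d) hL2 n hηL εU hεU hϱ0 hϱ1 hεs hεg hr0 zero_le_one zero_le_one hwinT
  have hβT : Mφ' * Mφ * Real.sqrt (c₁ / (c₀ * ((L : ℝ) ^ (n + 1)) ^ d)) *
      ((∏ j ∈ Finset.range (n + 1), (1 + Real.sqrt ((L : ℝ) ^ d) * (Real.sqrt (2 * d) * (102 * (d + 1) ^ 2 * L * εU j) +
          2 * (r₀ * (if j = 0 then 3 * 1 + (L : ℝ) ^ (n + 1) * (1 * η) else 2 * d * (L : ℝ) ^ (n + 1 - j) * (1 * η))) *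
            Real.sqrt (2 * (2 * d * (102 * (d + 1) ^ 2 * L * εU j) ^ 2 + ((L : ℝ) ^ d)⁻¹))))) -
        ∏ j ∈ Finset.range (n + 1), (1 + Real.sqrt ((L : ℝ) ^ d) * (Real.sqrt (2 * d) * (102 * (d + 1) ^ 2 * L * εU j)))) ≤ (4 * (Mφ * Mφ') * (d * Real.sqrt d) + 4 * (Mφ * Mφ') * d + 2 * (Mφ * Mφ') * Real.sqrt d + Mφ' * Mφ * (Real.exp 1 * Real.exp (Real.sqrt ((L : ℝ) ^ d) * (Real.sqrt (2 * d) * (102 * (d + 1) ^ 2 * L)) * (εs / (1 - ϱ))) * (Real.sqrt ((L : ℝ) ^ d) * ((3 * 1 + (2 * d + 1) * 1) * (2 * Real.sqrt (2 * (2 * d * (102 * (d + 1) ^ 2 * L * εs) ^ 2 + 1)))))) + 1) * r₀ := by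
    have hMM1 : Mφ' * Mφ * Real.sqrt (c₁ / (c₀ * ((L : ℝ) ^ (n + 1)) ^ d)) = Mφ' * Mφ := by rw [hW1, mul_one]
    rw [hMM1]
    have hMM : 0 ≤ Mφ' * Mφ := mul_nonneg hMφ' hMφ
    have hlin : (∏ j ∈ Finset.range (n + 1), (1 + Real.sqrt ((L : ℝ) ^ d) * (Real.sqrt (2 * d) * (102 * (d + 1) ^ 2 * L * εU j) +
          2 * (r₀ * (if j = 0 then 3 * 1 + (L : ℝ) ^ (n + 1) * (1 * η) else 2 * d * (L : ℝ) ^ (n + 1 - j) * (1 * η))) *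
            Real.sqrt (2 * (2 * d * (102 * (d + 1) ^ 2 * L * εU j) ^ 2 + ((L : ℝ) ^ d)⁻¹))))) -
        ∏ j ∈ Finset.range (n + 1), (1 + Real.sqrt ((L : ℝ) ^ d) * (Real.sqrt (2 * d) * (102 * (d + 1) ^ 2 * L * εU j))) ≤ (Real.exp 1 * Real.exp (Real.sqrt ((L : ℝ) ^ d) * (Real.sqrt (2 * d) * (102 * (d + 1) ^ 2 * L)) * (εs / (1 - ϱ))) * (Real.sqrt ((L : ℝ) ^ d) * ((3 * 1 + (2 * d + 1) * 1) * (2 * Real.sqrt (2 * (2 * d * (102 * (d + 1) ^ 2 * L * εs) ^ 2 + 1)))))) * r₀ := by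
      refine hdiff.trans (le_of_eq ?_); ring
    exact (mul_le_mul_of_nonneg_left hlin hMM).trans hβTs
  -- `small` with the curvature letter bounded by `p_K⁰`
  have small : (768 * Fintype.card (DirPair d) * Mτ * Mφ ^ 2 * (‖((η : ℂ)) ^ d‖ / c₀) * ‖((η : ℂ))⁻¹‖ ^ 2 * δ) / 2 + (21 + 3 * a) * ((4 * (Mφ * Mφ') * (d * Real.sqrt d) + 4 * (Mφ * Mφ') * d + 2 * (Mφ * Mφ') * Real.sqrt d + Mφ' * Mφ * (Real.exp 1 * Real.exp (Real.sqrt ((L : ℝ) ^ d) * (Real.sqrt (2 * d) * (102 * (d + 1) ^ 2 * L)) * (εs / (1 - ϱ))) * (Real.sqrt ((L : ℝ) ^ d) * ((3 * 1 + (2 * d + 1) * 1) * (2 * Real.sqrt (2 * (2 * d * (102 * (d + 1) ^ 2 * L * εs) ^ 2 + 1)))))) + 1) * r₀) ^ 2 + 4 * ((4 * (Mφ * Mφ') * (d * Real.sqrt d) + 4 * (Mφ * Mφ') * d + 2 * (Mφ * Mφ') * Real.sqrt d + Mφ' * Mφ * (Real.exp 1 * Real.exp (Real.sqrt ((L : ℝ)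 ^ d) * (Real.sqrt (2 * d) * (102 * (d + 1) ^ 2 * L)) * (εs / (1 - ϱ))) * (Real.sqrt ((L : ℝ) ^ d) * ((3 * 1 + (2 * d + 1) * 1) * (2 * Real.sqrt (2 * (2 * d * (102 * (d + 1) ^ 2 * L * εs) ^ 2 + 1)))))) + 1) * r₀) * Real.sqrt (M / Real.sqrt κ₁) +
      2 * ((6 * ((2 * (Mφ * Mφ') * Real.sqrt d + 2 * M + 1) * r₀ * (4 / γ' + M * ((4 / γ') ^ 2 * (3 + a' * (2 * M + 1))))) + 9 * ((2 * (Mφ * Mφ') * Real.sqrt d + 2 * M + 1) * r₀ * (4 / γ' + M * ((4 / γ') ^ 2 * (3 + a' * (2 * M + 1)))))) / Real.sqrt κ₁) * (Real.sqrt (M / Real.sqrt κ₁)) ^ 2 + 8 * pK0 * r₀ ≤ γ / 4 := by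
    have : (768 * Fintype.card (DirPair d) * Mτ * Mφ ^ 2 * (‖((η : ℂ)) ^ d‖ / c₀) * ‖((η : ℂ))⁻¹‖ ^ 2 * δ) / 2 ≤ pK0 / 2 := by linarith
    linarith [hsmall]
  -- `small2` at the diagonal `C_Q`
  have small2 : (4 * (Mφ * Mφ') * (d * Real.sqrt d) + 4 * (Mφ * Mφ') * d + 2 * (Mφ * Mφ') * Real.sqrt d + Mφ' * Mφ * (Real.exp 1 * Real.exp (Real.sqrt ((L : ℝ) ^ d) * (Real.sqrt (2 * d) * (102 * (d + 1) ^ 2 * L)) * (εs / (1 - ϱ))) * (Real.sqrt ((L : ℝ) ^ d) * ((3 * 1 + (2 * d + 1) * 1) * (2 * Real.sqrt (2 * (2 * d * (102 * (d + 1) ^ 2 * L * εs) ^ 2 + 1)))))) + 1) * r₀ * (4 / γ) * (2 * (Mφ' * Mφ * Real.sqrt (c₁ / (c₀ * ((L : ℝ) ^ (n + 1)) ^ d)) *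
        Real.exp (Real.sqrt ((L : ℝ) ^ d) * (Real.sqrt (2 * d) * (102 * (d + 1) ^ 2 * L)) * (εs / (1 - ϱ)))) + 1) +
      (Mφ' * Mφ * Real.sqrt (c₁ / (c₀ * ((L : ℝ) ^ (n + 1)) ^ d)) * Real.exp (Real.sqrt ((L : ℝ) ^ d) * (Real.sqrt (2 * d) * (102 * (d + 1) ^ 2 * L)) * (εs / (1 - ϱ)))) *
        ((Mφ' * Mφ * Real.sqrt (c₁ / (c₀ * ((L : ℝ) ^ (n + 1)) ^ d)) * Real.exp (Real.sqrt ((L : ℝ) ^ d) * (Real.sqrt (2 * d) * (102 * (d + 1) ^ 2 * L)) * (εs / (1 - ϱ)))) + 1) *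
        ((4 * (Mφ * Mφ') * (d * Real.sqrt d) + 4 * (Mφ * Mφ') * d + 2 * (Mφ * Mφ') * Real.sqrt d + Mφ' * Mφ * (Real.exp 1 * Real.exp (Real.sqrt ((L : ℝ) ^ d) * (Real.sqrt (2 * d) * (102 * (d + 1) ^ 2 * L)) * (εs / (1 - ϱ))) * (Real.sqrt ((L : ℝ) ^ d) * ((3 * 1 + (2 * d + 1) * 1) * (2 * Real.sqrt (2 * (2 * d * (102 * (d + 1) ^ 2 * L * εs) ^ 2 + 1)))))) + 1) * r₀ * (4 / γ * (2 * (8 / γ) + (8 / γ + 4 / γ) + 2 * ((8 / γ + 4 / γ * Real.sqrt (M / Real.sqrt κ₁)) + 4 / γ) +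
          a * (Mφ' * Mφ * Real.sqrt (c₁ / (c₀ * ((L : ℝ) ^ (n + 1)) ^ d)) * Real.exp (Real.sqrt ((L : ℝ) ^ d) * (Real.sqrt (2 * d) * (102 * (d + 1) ^ 2 * L)) * (εs / (1 - ϱ)))) * (4 / γ) +
          a * ((Mφ' * Mφ * Real.sqrt (c₁ / (c₀ * ((L : ℝ) ^ (n + 1)) ^ d)) * Real.exp (Real.sqrt ((L : ℝ) ^ d) * (Real.sqrt (2 * d) * (102 * (d + 1) ^ 2 * L)) * (εs / (1 - ϱ)))) + 1) * (4 / γ))) +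
          ((6 * ((2 * (Mφ * Mφ') * Real.sqrt d + 2 * M + 1) * r₀ * (4 / γ' + M * ((4 / γ') ^ 2 * (3 + a' * (2 * M + 1))))) + 9 * ((2 * (Mφ * Mφ') * Real.sqrt d + 2 * M + 1) * r₀ * (4 / γ' + M * ((4 / γ') ^ 2 * (3 + a' * (2 * M + 1)))))) / Real.sqrt κ₁) * ((8 / γ + 4 / γ * Real.sqrt (M / Real.sqrt κ₁)) * ((8 / γ + 4 / γ * Real.sqrt (M / Real.sqrt κ₁)) + 4 / γ)) + 8 * pK0 * r₀ * (4 / γ) ^ 2) ≤ μ₁ / 2 := by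
    have hCQ : Mφ' * Mφ * Real.sqrt (c₁ / (c₀ * ((L : ℝ) ^ (n + 1)) ^ d)) * Real.exp (Real.sqrt ((L : ℝ) ^ d) * (Real.sqrt (2 * d) * (102 * (d + 1) ^ 2 * L)) * (εs / (1 - ϱ))) =
        Mφ' * Mφ * Real.exp (Real.sqrt ((L : ℝ) ^ d) * (Real.sqrt (2 * d) * (102 * (d + 1) ^ 2 * L)) * (εs / (1 - ϱ))) := by rw [hW1, mul_one]
    rw [hCQ]
    exact hsmall2
  have hKre : ∀ f : BondL2K ℂ d (towerP L m (n + 1)) c₀ W, -((768 * Fintype.card (DirPair d) * Mτ * Mφ ^ 2 * (‖((η : ℂ)) ^ d‖ / c₀) * ‖((η : ℂ))⁻¹‖ ^ 2 * δ) * ‖f‖ ^ 2) ≤ RCLike.re ⟪f, curvOp φ τ η U f⟫_ℂ :=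
    fun f => re_inner_curvOp_self_ge φ hφ hstar τ hτ hMτ η U (fun b => B7Prop1Explicit.mem_U1.mp (hU b)) hδ hRe hIm f
  have hCQ0 : 0 ≤ Mφ' * Mφ * Real.sqrt (c₁ / (c₀ * ((L : ℝ) ^ (n + 1)) ^ d)) * Real.exp (Real.sqrt ((L : ℝ) ^ d) * (Real.sqrt (2 * d) * (102 * (d + 1) ^ 2 * L)) * (εs / (1 - ϱ))) := by positivity
  have h := norm_bondPoint_Kinv_le φ hφ hφ' hMφ hMφ' hη hηL U hU hRS τ hL1 α hα1 hU1 hreg a ha hm hpos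
    (QkW_surjective L m n φ U hL1 α hα1 hU1 hreg (c₀ := c₀) (c₁ := c₁) hαL) hγ hγ1 hβ0 hβ1 hβK0 le_rfl le_rfl hr0 hρ0 hρ8 (by positivity) hCQ0 hμ₁ hcoer hX1 hKre
    (norm_QkW_le_of_geometric_window L m n hL1 φ hMφ hMφ' hφ hφ' U α hα1 hU1 hreg εU hεU hUε hϱ0 hϱ1 hεs hεg (c₀ := c₀) (c₁ := c₁))
    hwin hβCC hβC hβD
    (hQK_of_chain_tower L m n φ hφ hφ' hMφ hMφ' hstar hη U hU hRS τ hτ hMτ hL1 hm α hα1 hU1 hreg εU hεU hUε hδ hRe hIm ha' hpos' hγ' hγ'1 hκ₁ hM coercive hκ hMQ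
      (ℓ := 1) (ℓ' := 1) (β' := (2 * (Mφ * Mφ') * Real.sqrt d + 2 * M + 1) * r₀) (ρ := ((6 * ((2 * (Mφ * Mφ') * Real.sqrt d + 2 * M + 1) * r₀ * (4 / γ' + M * ((4 / γ') ^ 2 * (3 + a' * (2 * M + 1))))) + 9 * ((2 * (Mφ * Mφ') * Real.sqrt d + 2 * M + 1) * r₀ * (4 / γ' + M * ((4 / γ') ^ 2 * (3 + a' * (2 * M + 1)))))) / Real.sqrt κ₁)) le_rfl le_rfl hβ'0 hβ'1 hwin hwin0 hwin1 hwin' hβT hβK hβ'D hβ'Q small' hwinκ le_rfl)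
    (B9Eq325ProjectionDivergenceQuarterKappaTower.norm_one_sub_RofUk_covDivL2K_le_sqrt L m n φ c₀ η U c₁ a' hRS hpos' ha' hM hκ₁ hMQ hκ)
    small small2 hrF y₀ y₁
  exact h

end Literature.MathematicalPhysics.QuantumFieldTheory.Balaban1983to89.B9Eq3126QG1QInvPointDecayTowerClosedRadius

end
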